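import Mathlib
import Literature.MathematicalPhysics.QuantumLattice.YangMillsClassical
import Literature.MathematicalPhysics.QuantumLattice.GrassmannIntegralProofs
import HarnessLib

/-!
# Stub `stub_weitzenbockDivergence` of line `zero-mode-floor-dilute-gas`
(crux `Summit.QuantumFields.QCD.Theses.NestedDissectionSea.EarlyCrosserLaw`,
item stmt-QuantumFields-13995, skeleton stub S2e)

The pointwise **Weitzenböck (Lichnerowicz) divergence identity** for Dirac-harmonic spinors on
flat `ℝ⁴ = EuclideanSpace ℝ (Fin 4)`, in coordinates: for a smooth matrix connection `A`
(`Connection`, Frobenius norm scope as in `YangMillsClassical`) with anti-Hermitian values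
`A_μ(x) := A x e_μ` acting on the colour index `c : Fin 3`, a smooth spinor field
`ψ : ℝ⁴ → Fin 4 → Fin 3 → ℂ`, `∇_μψ := ∂_μψ + A_μψ`, `⟨u, w⟩ := Σ_{s,c} conj (u s c) * w s c`,
`γ_μ = euclideanGamma μ` acting on the spinor index `s`, `F_μν = curvature A x e_μ e_ν` and
`𝔉ψ := Σ_{μ<ν} (γ_μγ_ν) ⊗ F_μν ψ`: if `Σ_μ γ_μ ∇_μψ = 0` everywhere then, at every point,
`Σ_μ ∂_μ Re⟨ψ, ∇_μψ⟩ = Σ_μ |∇_μψ|² − Re⟨ψ, 𝔉ψ⟩`.  It is proved for an arbitrary frame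
`e : Fin 4 → ℝ⁴` (`weitz_divergence`) and specialised to `e_μ = EuclideanSpace.single μ 1`.
Calculus (§1–§2): components of `ψ` and entries of `A` are `C^∞`, Leibniz rules for directional
derivatives, second partials commute (`ContDiffAt.isSymmSndFDerivAt`), the entrywise formula for
`curvature`, `∂_v Re⟨ψ, ∇_uψ⟩ = Re(⟨∂_vψ, ∇_uψ⟩ + ⟨ψ, ∂_v∇_uψ⟩)`, and `Σ_μ γ_μ ∂_v(∇_μψ) = 0` by
differentiating the Dirac equation.  Algebra (§3, on the jets at a point, `n_μ = ∇_μψ`,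
`DD_{μν} = ∇_μ∇_νψ`): anti-Hermiticity gives `⟨∂_μψ, n_μ⟩ = |n_μ|² + ⟨ψ, A_μ n_μ⟩`; symmetric
second partials give `DD_{μν} − DD_{νμ} = F_{μν}ψ`; the differentiated Dirac equation gives
`Σ_{μ,ν} γ_μγ_ν DD_{μν} = 0`, and splitting into `μ = ν` (`γ_μ² = 1`) and pairs `μ < ν`
(`γ_νγ_μ = −γ_μγ_ν`) yields `Σ_μ DD_{μμ} = −𝔉ψ`.  Mathlib only, plus the tree facts `Connection`,
`curvature`, `IsSmoothConnection`, `euclideanGamma`, `euclideanGamma_mul_self`,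
`euclideanGamma_mul_of_ne`.
-/

noncomputable section

open scoped BigOperators Matrix ContDiff Matrix.Norms.Frobenius
open Literature.MathematicalPhysics.QuantumLattice

namespace Summit.QuantumFields.QCD.Cruxes.EarlyCrosserLaw.ZeroModeFloorDiluteGas

section Calculus

variable {E : Type*} [NormedAddCommGroup E] [NormedSpace ℝ E]

/-- Directional derivative of a finite sum of differentiable complex functions. -/
theorem weitz_fderiv_sum {ι : Type*} (u : Finset ι) {f : ι → E → ℂ}
    (hf : ∀ i, Differentiable ℝ (f i)) (x v : E) :
    fderiv ℝ (fun y => ∑ i ∈ u, f i y) x v = ∑ i ∈ u, fderiv ℝ (f i) x v := by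
  rw [fderiv_fun_sum fun i _ => hf i x, sum_apply]

/-- Leibniz rule for the directional derivative of a product of complex functions. -/
theorem weitz_fderiv_mul {f g : E → ℂ} (hf : Differentiable ℝ f) (hg : Differentiable ℝ g)
    (x v : E) :
    fderiv ℝ (fun y => f y * g y) x v = fderiv ℝ f x v * g x + f x * fderiv ℝ g x v := by
  rw [fderiv_fun_mul (hf x) (hg x), add_apply, smul_apply, smul_apply, smul_eq_mul, smul_eq_mul]
  ring

/-- Directional derivative of the complex conjugate of a function. -/
theorem weitz_fderiv_conj {f : E → ℂ} (hf : Differentiable ℝ f) (x v : E) :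
    fderiv ℝ (fun y => starRingEnd ℂ (f y)) x v = starRingEnd ℂ (fderiv ℝ f x v) := by
  have h := (Complex.conjCLE.toContinuousLinearMap.hasFDerivAt.comp x (hf x).hasFDerivAt).fderiv
  rw [show (fun y => starRingEnd ℂ (f y)) = Complex.conjCLE.toContinuousLinearMap ∘ f from rfl, h]
  rfl

/-- The complex conjugate of a differentiable function is differentiable. -/
theorem weitz_differentiable_conj {f : E → ℂ} (hf : Differentiable ℝ f) :
    Differentiable ℝ (fun y => starRingEnd ℂ (f y)) :=
  Complex.conjCLE.toContinuousLinearMap.differentiable.comp hf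

/-- Directional derivative of the real part of a complex function. -/
theorem weitz_fderiv_re {f : E → ℂ} (hf : Differentiable ℝ f) (x v : E) :
    fderiv ℝ (fun y => (f y).re) x v = (fderiv ℝ f x v).re := by
  have h := (Complex.reCLM.hasFDerivAt.comp x (hf x).hasFDerivAt).fderiv
  rw [show (fun y => (f y).re) = Complex.reCLM ∘ f from rfl, h]
  rfl

/-- A directional derivative of a smooth complex function is smooth. -/
theorem weitz_contDiff_fderiv_apply {f : E → ℂ} (hf : ContDiff ℝ ∞ f) (v : E) :
    ContDiff ℝ ∞ (fun y => fderiv ℝ f y v) :=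
  (hf.fderiv_right (m := ∞) (by simp)).clm_apply contDiff_const

/-- Second directional derivatives of a smooth complex function commute. -/
theorem weitz_fderiv_fderiv_symm {f : E → ℂ} (hf : ContDiff ℝ ∞ f) (x v w : E) :
    fderiv ℝ (fun y => fderiv ℝ f y v) x w = fderiv ℝ (fun y => fderiv ℝ f y w) x v := by
  have hd : DifferentiableAt ℝ (fderiv ℝ f) x :=
    ((hf.fderiv_right (m := ∞) (by simp)).differentiable (by simp)).differentiableAt
  have hs := (hf.contDiffAt (x := x)).isSymmSndFDerivAt (by
    simp only [minSmoothness_of_isRCLikeNormedField]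
    exact ENat.natCast_le_of_coe_top_le_withTop le_rfl 2)
  rw [fderiv_clm_apply hd (differentiableAt_const _),
    fderiv_clm_apply hd (differentiableAt_const _)]
  simp only [fderiv_fun_const, Pi.zero_apply, ContinuousLinearMap.comp_zero, zero_add,
    ContinuousLinearMap.flip_apply]
  exact hs w v

end Calculus

section Components

variable {A : Connection (EuclideanSpace ℝ (Fin 4)) (Matrix (Fin 3) (Fin 3) ℂ)}
  {ψ : EuclideanSpace ℝ (Fin 4) → Fin 4 → Fin 3 → ℂ}

/-- Entries of a smooth connection are smooth (the entry map is a continuous linear form). -/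
theorem weitz_contDiff_connection_entry (hA : IsSmoothConnection A)
    (v : EuclideanSpace ℝ (Fin 4)) (c c' : Fin 3) : ContDiff ℝ ∞ (fun y => A y v c c') :=
  (LinearMap.toContinuousLinearMap (Matrix.entryLinearMap ℝ ℂ c c')).contDiff.comp
    (hA.clm_apply contDiff_const)

/-- Entrywise formula for the curvature `F(u,v) = ∂ᵤA_v − ∂ᵥA_u + [A_u, A_v]`: the entries of
the derivative of `y ↦ A y v` are the derivatives of the entries (the closing `rfl` identifies the
Frobenius-topology instance inside `curvature` with the product topology). -/
theorem weitz_curvature_entry (hA : IsSmoothConnection A)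
    (x u v : EuclideanSpace ℝ (Fin 4)) (c c' : Fin 3) :
    curvature A x u v c c' = fderiv ℝ (fun y => A y v c c') x u - fderiv ℝ (fun y => A y u c c') x v
      + ∑ k, (A x u c k * A x v k c' - A x v c k * A x u k c') := by
  have key : ∀ u v : EuclideanSpace ℝ (Fin 4),
      fderiv ℝ (fun y => A y v c c') x u = fderiv ℝ (fun y => A y v) x u c c' := by
    intro u v
    have hd : DifferentiableAt ℝ (fun y => A y v) x :=
      ((hA.clm_apply contDiff_const).differentiable (by simp)).differentiableAt
    rw [show (fun y => A y v c c') =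
      (LinearMap.toContinuousLinearMap (Matrix.entryLinearMap ℝ ℂ c c')) ∘ (fun y => A y v) from rfl,
      ((LinearMap.toContinuousLinearMap (Matrix.entryLinearMap ℝ ℂ c c')).hasFDerivAt.comp x
        hd.hasFDerivAt).fderiv]
    rfl
  rw [key, key]
  unfold curvature
  rw [Ring.lie_def, Matrix.add_apply, Matrix.sub_apply, Matrix.sub_apply, Matrix.mul_apply,
    Matrix.mul_apply, ← Finset.sum_sub_distrib]
  rfl

/-- Components of a smooth spinor field are smooth. -/
theorem weitz_contDiff_spinor_entry (hψ : ContDiff ℝ ∞ ψ) (s : Fin 4) (c : Fin 3) :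
    ContDiff ℝ ∞ (fun z => ψ z s c) :=
  contDiff_pi.1 (contDiff_pi.1 hψ s) c

/-- The components `(∇_u ψ)_{sc} = ∂_u ψ_{sc} + Σ_{c'} (A_u)_{cc'} ψ_{sc'}` are smooth. -/
theorem weitz_contDiff_covDeriv (hA : IsSmoothConnection A) (hψ : ContDiff ℝ ∞ ψ)
    (u : EuclideanSpace ℝ (Fin 4)) (s : Fin 4) (c : Fin 3) :
    ContDiff ℝ ∞ (fun y => fderiv ℝ (fun z => ψ z s c) y u + ∑ c', A y u c c' * ψ y s c') :=
  (weitz_contDiff_fderiv_apply (weitz_contDiff_spinor_entry hψ s c) u).add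
    (ContDiff.sum fun c' _ => (weitz_contDiff_connection_entry hA u c c').mul
      (weitz_contDiff_spinor_entry hψ s c'))

/-- Leibniz expansion of a directional derivative of the covariant derivative:
`∂_v (∇_u ψ)_{sc} = ∂_v∂_u ψ_{sc} + Σ_{c'} [(∂_v A_u)_{cc'} ψ_{sc'} + (A_u)_{cc'} ∂_v ψ_{sc'}]`. -/
theorem weitz_fderiv_covDeriv (hA : IsSmoothConnection A) (hψ : ContDiff ℝ ∞ ψ)
    (x u v : EuclideanSpace ℝ (Fin 4)) (s : Fin 4) (c : Fin 3) :
    fderiv ℝ (fun y => fderiv ℝ (fun z => ψ z s c) y u + ∑ c', A y u c c' * ψ y s c') x v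
      = fderiv ℝ (fun y => fderiv ℝ (fun z => ψ z s c) y u) x v
        + ∑ c', (fderiv ℝ (fun y => A y u c c') x v * ψ x s c'
          + A x u c c' * fderiv ℝ (fun z => ψ z s c') x v) := by
  have hP : ∀ s c, Differentiable ℝ (fun z => ψ z s c) := fun s c =>
    (weitz_contDiff_spinor_entry hψ s c).differentiable (by simp)
  have ha : ∀ c', Differentiable ℝ (fun y => A y u c c' * ψ y s c') := fun c' =>
    ((weitz_contDiff_connection_entry hA u c c').differentiable (by simp)).fun_mul (hP s c')
  have hdP : Differentiable ℝ (fun y => fderiv ℝ (fun z => ψ z s c) y u) :=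
    (weitz_contDiff_fderiv_apply (weitz_contDiff_spinor_entry hψ s c) u).differentiable (by simp)
  rw [fderiv_fun_add (hdP x) ((Differentiable.fun_sum fun c' _ => ha c') x), add_apply,
    weitz_fderiv_sum _ ha]
  exact congrArg _ (Finset.sum_congr rfl fun c' _ => weitz_fderiv_mul
    ((weitz_contDiff_connection_entry hA u c c').differentiable (by simp)) (hP s c') x v)

/-- Leibniz rule for the pairing `Re⟨ψ, ∇_u ψ⟩ = Re Σ_{s,c} conj(ψ_{sc}) (∇_u ψ)_{sc}` along `v`:
`∂_v Re⟨ψ, ∇_uψ⟩ = Re Σ_{s,c} (conj(∂_vψ_{sc}) (∇_uψ)_{sc} + conj(ψ_{sc}) ∂_v(∇_uψ)_{sc})`. -/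
theorem weitz_fderiv_pairing (hA : IsSmoothConnection A) (hψ : ContDiff ℝ ∞ ψ)
    (x u v : EuclideanSpace ℝ (Fin 4)) :
    fderiv ℝ (fun y => (∑ s, ∑ c, starRingEnd ℂ (ψ y s c)
        * (fderiv ℝ (fun z => ψ z s c) y u + ∑ c', A y u c c' * ψ y s c')).re) x v
      = (∑ s, ∑ c, (starRingEnd ℂ (fderiv ℝ (fun z => ψ z s c) x v)
          * (fderiv ℝ (fun z => ψ z s c) x u + ∑ c', A x u c c' * ψ x s c')
        + starRingEnd ℂ (ψ x s c)
          * fderiv ℝ (fun y => fderiv ℝ (fun z => ψ z s c) y u + ∑ c', A y u c c' * ψ y s c')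
            x v)).re := by
  have hP : ∀ s c, Differentiable ℝ (fun z => ψ z s c) := fun s c =>
    (weitz_contDiff_spinor_entry hψ s c).differentiable (by simp)
  have hN : ∀ s c, Differentiable ℝ
      (fun y => fderiv ℝ (fun z => ψ z s c) y u + ∑ c', A y u c c' * ψ y s c') := fun s c =>
    (weitz_contDiff_covDeriv hA hψ u s c).differentiable (by simp)
  have hT : ∀ s c, Differentiable ℝ (fun y => starRingEnd ℂ (ψ y s c)
      * (fderiv ℝ (fun z => ψ z s c) y u + ∑ c', A y u c c' * ψ y s c')) := fun s c =>
    (weitz_differentiable_conj (hP s c)).fun_mul (hN s c)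
  rw [weitz_fderiv_re (Differentiable.fun_sum fun s _ => Differentiable.fun_sum fun c _ => hT s c),
    weitz_fderiv_sum _ (fun s => Differentiable.fun_sum fun c _ => hT s c)]
  refine congrArg _ (Finset.sum_congr rfl fun s _ => ?_)
  rw [weitz_fderiv_sum _ (fun c => hT s c)]
  refine Finset.sum_congr rfl fun c _ => ?_
  rw [weitz_fderiv_mul (weitz_differentiable_conj (hP s c)) (hN s c), weitz_fderiv_conj (hP s c)]

/-- Differentiating the Dirac equation `Σ_μ γ_μ ∇_μ ψ ≡ 0`: `Σ_μ γ_μ ∂_v(∇_μ ψ) = 0`. -/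
theorem weitz_fderiv_dirac (hA : IsSmoothConnection A) (hψ : ContDiff ℝ ∞ ψ)
    (e : Fin 4 → EuclideanSpace ℝ (Fin 4))
    (hD : ∀ x s c, ∑ μ : Fin 4, ∑ s' : Fin 4, euclideanGamma μ s s'
      * (fderiv ℝ (fun y => ψ y s' c) x (e μ) + ∑ c' : Fin 3, A x (e μ) c c' * ψ x s' c') = 0)
    (x v : EuclideanSpace ℝ (Fin 4)) (s : Fin 4) (c : Fin 3) :
    ∑ μ : Fin 4, ∑ s' : Fin 4, euclideanGamma μ s s'
      * fderiv ℝ (fun y => fderiv ℝ (fun z => ψ z s' c) y (e μ)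
          + ∑ c' : Fin 3, A y (e μ) c c' * ψ y s' c') x v = 0 := by
  have hN : ∀ μ s', Differentiable ℝ (fun y => euclideanGamma μ s s'
      * (fderiv ℝ (fun z => ψ z s' c) y (e μ) + ∑ c', A y (e μ) c c' * ψ y s' c')) :=
    fun μ s' => ((weitz_contDiff_covDeriv hA hψ (e μ) s' c).differentiable (by simp)).const_mul _
  have h0 := congrArg (fun f : EuclideanSpace ℝ (Fin 4) → ℂ => fderiv ℝ f x v)
    (funext fun y => hD y s c)
  simp only [fderiv_fun_const, Pi.zero_apply, zero_apply] at h0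
  rw [weitz_fderiv_sum _ (fun μ => Differentiable.fun_sum fun s' _ => hN μ s')] at h0
  rw [← h0]
  refine Finset.sum_congr rfl fun μ _ => ?_
  rw [weitz_fderiv_sum _ (fun s' => hN μ s')]
  refine Finset.sum_congr rfl fun s' _ => ?_
  rw [fderiv_const_mul ((weitz_contDiff_covDeriv hA hψ (e μ) s' c).differentiable (by simp) x)]
  rfl

end Components

section Algebra

/-- Splitting a double sum over `Fin 4 × Fin 4` into its diagonal and the pairs `μ < ν`. -/
theorem weitz_sum_sum_eq_diag_add_pairs (f : Fin 4 → Fin 4 → ℂ) :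
    ∑ μ, ∑ ν, f μ ν = ∑ μ, f μ μ + ∑ μ, ∑ ν, if μ < ν then f μ ν + f ν μ else 0 := by
  simp only [Fin.sum_univ_four, Fin.isValue]
  simp only [lt_self_iff_false, if_false, Fin.reduceLT, if_true]
  ring

/-- Anti-Hermiticity moves the connection across the pairing:
`⟨q, n⟩ = Σ ‖n‖² + ⟨p, a n⟩` when `n = q + a p` and `aᴴ = -a`. -/
theorem weitz_pairing_split (p q n : Fin 4 → Fin 3 → ℂ) (a : Matrix (Fin 3) (Fin 3) ℂ)
    (haH : ∀ c c', a c c' = -starRingEnd ℂ (a c' c))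
    (hn : ∀ s c, n s c = q s c + ∑ c', a c c' * p s c') :
    ∑ s, ∑ c, starRingEnd ℂ (q s c) * n s c = ((∑ s, ∑ c, ‖n s c‖ ^ 2 : ℝ) : ℂ)
        + ∑ s, ∑ c, starRingEnd ℂ (p s c) * ∑ c', a c c' * n s c' := by
  have hq : ∀ s c, q s c = n s c - ∑ c', a c c' * p s c' := fun s c => by rw [hn]; ring
  have haH' : ∀ c c', starRingEnd ℂ (a c c') = -a c' c := fun c c' => by
    rw [haH c c', map_neg, Complex.conj_conj]
  simp_rw [hq, map_sub, map_sum, map_mul, haH', sub_mul, Finset.sum_sub_distrib, sub_eq_add_neg]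
  push_cast
  congr 1
  · exact Finset.sum_congr rfl fun s _ => Finset.sum_congr rfl fun c _ => Complex.conj_mul' _
  rw [← Finset.sum_neg_distrib]
  refine Finset.sum_congr rfl fun s _ => ?_
  simp only [Finset.sum_mul, Finset.mul_sum, neg_mul, Finset.sum_neg_distrib, neg_neg]
  rw [Finset.sum_comm]
  exact Finset.sum_congr rfl fun c _ => Finset.sum_congr rfl fun c' _ => by ring

variable (p : Fin 4 → Fin 3 → ℂ) (q n : Fin 4 → Fin 4 → Fin 3 → ℂ)
  (a : Fin 4 → Matrix (Fin 3) (Fin 3) ℂ) (b : Fin 4 → Fin 4 → Fin 3 → Fin 3 → ℂ)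
  (r dn DD : Fin 4 → Fin 4 → Fin 4 → Fin 3 → ℂ) (F : Fin 4 → Fin 4 → Matrix (Fin 3) (Fin 3) ℂ)

/-- **Curvature as a commutator of covariant derivatives**: `∇_μ∇_νψ − ∇_ν∇_μψ = F_{μν}ψ` on the
jets `n_μ = q_μ + a_μ p` (`∇_μψ`), `dn_{νμ} = r_{νμ} + b_{νμ} p + a_μ q_ν` (`∂_ν∇_μψ`, `r`
symmetric), `DD_{μν} = dn_{μν} + a_μ n_ν` (`∇_μ∇_νψ`), `F_{μν} = b_{μν} − b_{νμ} + [a_μ, a_ν]`. -/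
theorem weitz_covDeriv_comm
    (hn : ∀ μ s c, n μ s c = q μ s c + ∑ c', a μ c c' * p s c')
    (hr : ∀ μ ν s c, r μ ν s c = r ν μ s c)
    (hdn : ∀ ν μ s c, dn ν μ s c = r ν μ s c + ∑ c', (b ν μ c c' * p s c' + a μ c c' * q ν s c'))
    (hDD : ∀ μ ν s c, DD μ ν s c = dn μ ν s c + ∑ c', a μ c c' * n ν s c')
    (hF : ∀ μ ν c c', F μ ν c c' = b μ ν c c' - b ν μ c c'
      + ∑ k, (a μ c k * a ν k c' - a ν c k * a μ k c'))
    (μ ν s : Fin 4) (c : Fin 3) :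
    DD μ ν s c - DD ν μ s c = ∑ c', F μ ν c c' * p s c' := by
  simp only [hDD, hdn, hn, hF, Fin.sum_univ_three]
  linear_combination hr μ ν s c

/-- The Dirac equation differentiated covariantly and contracted: `Σ_{μ,ν} γ_μγ_ν ∇_μ∇_νψ = 0`. -/
theorem weitz_dirac_dirac_covDeriv
    (hDD : ∀ μ ν s c, DD μ ν s c = dn μ ν s c + ∑ c', a μ c c' * n ν s c')
    (hDirac : ∀ s c, ∑ μ, ∑ s', euclideanGamma μ s s' * n μ s' c = 0)
    (hdDirac : ∀ ν s c, ∑ μ, ∑ s', euclideanGamma μ s s' * dn ν μ s' c = 0)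
    (s : Fin 4) (c : Fin 3) :
    ∑ μ, ∑ ν, ∑ s', (euclideanGamma μ * euclideanGamma ν) s s' * DD μ ν s' c = 0 := by
  -- `Σ_ν γ_ν DD_{μν} = 0` for every `μ` and spinor index `t`.
  have h1 : ∀ μ t, ∑ ν, ∑ s', euclideanGamma ν t s' * DD μ ν s' c = 0 := by
    intro μ t
    have h2 : ∀ ν s', euclideanGamma ν t s' * DD μ ν s' c = euclideanGamma ν t s' * dn μ ν s' c
        + ∑ c', (euclideanGamma ν t s' * n ν s' c') * a μ c c' := by
      intro ν s'
      rw [hDD, mul_add, Finset.mul_sum]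
      exact congrArg _ (Finset.sum_congr rfl fun c' _ => by ring)
    simp_rw [h2, Finset.sum_add_distrib, hdDirac, zero_add]
    rw [(Finset.sum_congr rfl fun _ _ => Finset.sum_comm).trans Finset.sum_comm]
    simp [← Finset.sum_mul, hDirac]
  -- contract with `γ_μ` and sum over `μ`.
  refine Finset.sum_eq_zero fun μ _ => ?_
  calc ∑ ν, ∑ s', (euclideanGamma μ * euclideanGamma ν) s s' * DD μ ν s' c
      = ∑ ν, ∑ s', ∑ t, euclideanGamma μ s t * (euclideanGamma ν t s' * DD μ ν s' c) :=
        Finset.sum_congr rfl fun ν _ => Finset.sum_congr rfl fun s' _ => by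
          rw [Matrix.mul_apply, Finset.sum_mul]
          exact Finset.sum_congr rfl fun t _ => mul_assoc _ _ _
    _ = ∑ t, euclideanGamma μ s t * ∑ ν, ∑ s', euclideanGamma ν t s' * DD μ ν s' c := by
        rw [(Finset.sum_congr rfl fun _ _ => Finset.sum_comm).trans Finset.sum_comm]
        simp_rw [Finset.mul_sum]
    _ = 0 := by simp [h1]

/-- **The algebraic core of the Weitzenböck divergence identity** on the jets at a point:
`Σ_μ Re(⟨q_μ, n_μ⟩ + ⟨p, dn_{μμ}⟩) = Σ_μ |n_μ|² − Re⟨p, Σ_{μ<ν} γ_μγ_ν F_{μν} p⟩`. -/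
theorem weitz_algebra
    (haH : ∀ μ c c', a μ c c' = -starRingEnd ℂ (a μ c' c))
    (hn : ∀ μ s c, n μ s c = q μ s c + ∑ c', a μ c c' * p s c')
    (hr : ∀ μ ν s c, r μ ν s c = r ν μ s c)
    (hdn : ∀ ν μ s c, dn ν μ s c = r ν μ s c + ∑ c', (b ν μ c c' * p s c' + a μ c c' * q ν s c'))
    (hF : ∀ μ ν c c', F μ ν c c' = b μ ν c c' - b ν μ c c'
      + ∑ k, (a μ c k * a ν k c' - a ν c k * a μ k c'))
    (hDirac : ∀ s c, ∑ μ, ∑ s', euclideanGamma μ s s' * n μ s' c = 0)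
    (hdDirac : ∀ ν s c, ∑ μ, ∑ s', euclideanGamma μ s s' * dn ν μ s' c = 0) :
    ∑ μ, (∑ s, ∑ c, (starRingEnd ℂ (q μ s c) * n μ s c + starRingEnd ℂ (p s c) * dn μ μ s c)).re
      = (∑ μ, ∑ s, ∑ c, ‖n μ s c‖ ^ 2)
        - (∑ s, ∑ c, starRingEnd ℂ (p s c) * (∑ μ, ∑ ν, if μ < ν then
            ∑ s', (euclideanGamma μ * euclideanGamma ν) s s' * ∑ c', F μ ν c c' * p s' c'
            else 0)).re := by
  -- per direction, `⟨q_μ, n_μ⟩ + ⟨p, dn_{μμ}⟩ = |n_μ|² + ⟨p, DD_{μμ}⟩`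
  have h1 : ∀ μ, ∑ s, ∑ c, (starRingEnd ℂ (q μ s c) * n μ s c + starRingEnd ℂ (p s c) * dn μ μ s c)
      = ((∑ s, ∑ c, ‖n μ s c‖ ^ 2 : ℝ) : ℂ)
        + ∑ s, ∑ c, starRingEnd ℂ (p s c) * (dn μ μ s c + ∑ c', a μ c c' * n μ s c') := by
    intro μ
    simp only [Finset.sum_add_distrib, mul_add]
    rw [weitz_pairing_split p (q μ) (n μ) (a μ) (haH μ) (hn μ)]
    ring
  simp_rw [h1, Complex.add_re, Complex.ofReal_re, Finset.sum_add_distrib]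
  -- the Laplacian term `Σ_μ DD_{μμ} = -𝔉 p`
  have h2 : ∀ s c, ∑ μ, (dn μ μ s c + ∑ c', a μ c c' * n μ s c') = -∑ μ, ∑ ν, if μ < ν then
      ∑ s', (euclideanGamma μ * euclideanGamma ν) s s' * ∑ c', F μ ν c c' * p s' c' else 0 := by
    intro s c
    set DD : Fin 4 → Fin 4 → Fin 4 → Fin 3 → ℂ := fun μ ν s c => dn μ ν s c + ∑ c', a μ c c' * n ν s c'
    have hDD : ∀ μ ν s c, DD μ ν s c = dn μ ν s c + ∑ c', a μ c c' * n ν s c' := fun _ _ _ _ => rfl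
    have h0 := weitz_dirac_dirac_covDeriv n a dn DD hDD hDirac hdDirac s c
    rw [weitz_sum_sum_eq_diag_add_pairs] at h0
    simp_rw [euclideanGamma_mul_self] at h0
    simp only [Matrix.one_apply, ite_mul, one_mul, zero_mul, Finset.sum_ite_eq,
      Finset.mem_univ, if_true] at h0
    have hsum : (∑ μ, ∑ ν, if μ < ν then ∑ s', (euclideanGamma μ * euclideanGamma ν) s s'
          * ∑ c', F μ ν c c' * p s' c' else 0)
        = ∑ μ, ∑ ν, if μ < ν then
          (∑ s', (euclideanGamma μ * euclideanGamma ν) s s' * DD μ ν s' c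
            + ∑ s', (euclideanGamma ν * euclideanGamma μ) s s' * DD ν μ s' c) else 0 := by
      refine Finset.sum_congr rfl fun μ _ => Finset.sum_congr rfl fun ν _ => ?_
      split_ifs with h
      · rw [euclideanGamma_mul_of_ne (Ne.symm h.ne), ← Finset.sum_add_distrib]
        exact Finset.sum_congr rfl fun s' _ => by
          rw [← weitz_covDeriv_comm p q n a b r dn DD F hn hr hdn hDD hF, Matrix.neg_apply]; ring
      · rfl
    rw [hsum]
    linear_combination h0
  rw [sub_eq_add_neg, ← Complex.re_sum, ← Complex.neg_re]
  congr 2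
  rw [Finset.sum_comm, ← Finset.sum_neg_distrib]
  refine Finset.sum_congr rfl fun s _ => ?_
  rw [Finset.sum_comm, ← Finset.sum_neg_distrib]
  refine Finset.sum_congr rfl fun c _ => ?_
  rw [← Finset.mul_sum, h2 s c, mul_neg]

end Algebra

/-- **The Weitzenböck divergence identity in an arbitrary frame** `e : Fin 4 → ℝ⁴`: for a smooth
anti-Hermitian connection `A`, a smooth spinor field `ψ` with `Σ_μ γ_μ ∇_{e μ} ψ = 0`, and
every point `x`, `Σ_μ ∂_{e μ} Re⟨ψ, ∇_{e μ}ψ⟩ (x) = Σ_μ |∇_{e μ}ψ(x)|² − Re⟨ψ(x), 𝔉ψ(x)⟩` with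
`𝔉ψ := Σ_{μ<ν} (γ_μγ_ν) ⊗ (curvature A x (e μ) (e ν)) ψ`.  Proof: the calculus of §2 produces
the jets and relations fed to the pointwise algebra `weitz_algebra` of §3. -/
theorem weitz_divergence (A : Connection (EuclideanSpace ℝ (Fin 4)) (Matrix (Fin 3) (Fin 3) ℂ))
    (ψ : EuclideanSpace ℝ (Fin 4) → Fin 4 → Fin 3 → ℂ) (hA : IsSmoothConnection A)
    (hAH : ∀ x v, (A x v)ᴴ = -(A x v)) (hψ : ContDiff ℝ ∞ ψ)
    (e : Fin 4 → EuclideanSpace ℝ (Fin 4))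
    (hD : ∀ x s c, ∑ μ : Fin 4, ∑ s' : Fin 4, euclideanGamma μ s s'
      * (fderiv ℝ (fun y => ψ y s' c) x (e μ) + ∑ c' : Fin 3, A x (e μ) c c' * ψ x s' c') = 0)
    (x : EuclideanSpace ℝ (Fin 4)) :
    ∑ μ : Fin 4, fderiv ℝ (fun y => (∑ s, ∑ c, starRingEnd ℂ (ψ y s c)
        * (fderiv ℝ (fun z => ψ z s c) y (e μ) + ∑ c' : Fin 3, A y (e μ) c c' * ψ y s c')).re)
        x (e μ)
      = (∑ μ : Fin 4, ∑ s, ∑ c,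
          ‖fderiv ℝ (fun z => ψ z s c) x (e μ) + ∑ c' : Fin 3, A x (e μ) c c' * ψ x s c'‖ ^ 2)
        - (∑ s, ∑ c, starRingEnd ℂ (ψ x s c) * (∑ μ : Fin 4, ∑ ν : Fin 4, if μ < ν then
            ∑ s' : Fin 4, (euclideanGamma μ * euclideanGamma ν) s s'
              * ∑ c' : Fin 3, curvature A x (e μ) (e ν) c c' * ψ x s' c' else 0)).re := by
  have haH : ∀ (μ : Fin 4) (c c' : Fin 3), A x (e μ) c c' = -starRingEnd ℂ (A x (e μ) c' c) := by
    intro μ c c'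
    have h := congrFun (congrFun (hAH x (e μ)) c) c'
    rw [Matrix.conjTranspose_apply, Matrix.neg_apply] at h
    rw [starRingEnd_apply, h, neg_neg]
  refine Eq.trans (Finset.sum_congr rfl fun μ _ => weitz_fderiv_pairing hA hψ x (e μ) (e μ))
    (weitz_algebra (fun s c => ψ x s c) (fun μ s c => fderiv ℝ (fun z => ψ z s c) x (e μ))
      (fun μ s c => fderiv ℝ (fun z => ψ z s c) x (e μ) + ∑ c' : Fin 3, A x (e μ) c c' * ψ x s c')
      (fun μ => A x (e μ)) (fun ν μ c c' => fderiv ℝ (fun y => A y (e μ) c c') x (e ν))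
      (fun ν μ s c => fderiv ℝ (fun y => fderiv ℝ (fun z => ψ z s c) y (e μ)) x (e ν))
      (fun ν μ s c => fderiv ℝ (fun y => fderiv ℝ (fun z => ψ z s c) y (e μ)
        + ∑ c' : Fin 3, A y (e μ) c c' * ψ y s c') x (e ν))
      (fun μ ν => curvature A x (e μ) (e ν)) haH (fun _ _ _ => rfl)
      (fun μ ν s c => weitz_fderiv_fderiv_symm (weitz_contDiff_spinor_entry hψ s c) x (e ν) (e μ))
      (fun ν μ s c => weitz_fderiv_covDeriv hA hψ x (e μ) (e ν) s c)
      (fun μ ν c c' => weitz_curvature_entry hA x (e μ) (e ν) c c') (hD x)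
      (fun ν s c => weitz_fderiv_dirac hA hψ e hD x (e ν) s c))

/-- **S2e `stub_weitzenbockDivergence` — the pointwise Weitzenböck (Lichnerowicz) divergence
identity for Dirac-harmonic spinors on flat `ℝ⁴`** (registered stub of line
`zero-mode-floor-dilute-gas`): `weitz_divergence` in the coordinate frame
`e_μ = EuclideanSpace.single μ 1`. -/
theorem stub_weitzenbockDivergence :
    ∀ (A : Connection (EuclideanSpace ℝ (Fin 4)) (Matrix (Fin 3) (Fin 3) ℂ)) (ψ : EuclideanSpace ℝ (Fin 4) → Fin 4 → Fin 3 → ℂ), IsSmoothConnection A → (∀ x v, (A x v)ᴴ = -(A x v)) → ContDiff ℝ ((⊤ : ℕ∞) : WithTop ℕ∞) ψ → (∀ x s c, ∑ μ : Fin 4, ∑ s' : Fin 4, euclideanGamma μ s s' * (fderiv ℝ (fun y => ψ y s' c) x (EuclideanSpace.single μ (1 : ℝ)) + ∑ c' : Fin 3, A x (EuclideanSpace.single μ (1 : ℝ)) c c' * ψ x s' c') = 0) → ∀ x : EuclideanSpace ℝ (Fin 4), ∑ μ : Fin 4, fderiv ℝ (fun y => (∑ s, ∑ c, starRingEnd ℂ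 (ψ y s c) * (fderiv ℝ (fun z => ψ z s c) y (EuclideanSpace.single μ (1 : ℝ)) + ∑ c' : Fin 3, A y (EuclideanSpace.single μ (1 : ℝ)) c c' * ψ y s c')).re) x (EuclideanSpace.single μ (1 : ℝ)) = (∑ μ : Fin 4, ∑ s, ∑ c, ‖fderiv ℝ (fun z => ψ z s c) x (EuclideanSpace.single μ (1 : ℝ)) + ∑ c' : Fin 3, A x (EuclideanSpace.single μ (1 : ℝ)) c c' * ψ x s c'‖ ^ 2) - (∑ s, ∑ c, starRingEnd ℂ (ψ x s c) * (∑ μ : Fin 4, ∑ ν : Fin 4, if μ < ν then ∑ s' : Fin 4, (euclideanGamma μ * euclideanGamma ν) s s' * ∑ c' : Fin 3, curvature A x (EuclideanSpace.single μ (1 : ℝ)) (EuclideanSpace.single ν (1 : ℝ)) c c' * ψ x s' c' else 0)).re := by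
  intro A ψ hA hAH hψ hD x
  exact weitz_divergence A ψ hA hAH hψ (fun μ => EuclideanSpace.single μ (1 : ℝ)) hD x

end Summit.QuantumFields.QCD.Cruxes.EarlyCrosserLaw.ZeroModeFloorDiluteGas
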